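import Mathlib
import Literature.MathematicalPhysics.QuantumFieldTheory.Balaban1983to89.B6Ineq249Proof
import Literature.MathematicalPhysics.QuantumFieldTheory.Balaban1983to89.B6Ineq266Proof

/-!
# `Balaban1983to89.B6Ineq244BoxProof` — T. Bałaban, *Propagators and renormalization transformations for lattice gauge
theories. II*, Commun. Math. Phys. **96** (1984) 223–250 [Balaban1984PropagatorsII]: **(2.44) `|(K(h_□)G′(□)h_□λ)(x)| ≤
O(M⁻¹)e^{−δ₀|x−y|}|λ|` PROVED from (2.43) on the printed one-level cube cover** (blocks = sites, the box model of
`B6CoverBox`), with the O(M⁻¹) EXPLICIT — the commutator `K(h_□) = h_□Δ′_a − Δ′_ah_□` of (2.38)/(2.40) is small because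
the cut-off `h_□` varies on the scale M — hence (2.51) and the convergence of (2.50) on that model from (2.43) ALONE

statement-level skeleton of published theorems with citation tags; proofs where landed; nothing here is a claim about the Yang–Mills mass gap.
PDF held: `paper:balaban1984-cmp96-propagators-rt-ii` (journal page = PDF page + 222); p. 230 [PDF 8] and p. 234 [PDF 12]
read this session (`lit read paper:balaban1984-cmp96-propagators-rt-ii --pages 8-12` and the ×2 renders
`run/shared/lean/pub/pub-balaban/b2b-balaban-ref1/pages/1984-cmp96-propagators-rt-II/1984-cmp96-propagators-rt-II-p008-x2.png`).

CITATION HEADER (cell `lit-balaban`, Phase-2 proof seat `p01` (gen 2) = unit `lit-balaban-p01`, HOME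
`run/shared/lean/pub/lit-balaban/` (`PHASE2-TARGETS.md` §G, ruling G.5-34(d)); SKELETON row **`B6.Eq2.44`** ((2.44) p. 230,
kind «model-instance» on the printed cover, blocks = sites) and row `B6.Eq2.51` ((2.51) p. 232) on the same model;
companion of this seat's `…B6Ineq249Proof` ((2.49)–(2.51), IMPORTED, not modified) and `…B6Ineq266Proof` ((2.64)–(2.66),
which consumes this file's (2.44) for "(2.43) alone ⇒ (2.66)").  Reused BY NAME: `B6Eq250.bTerm/kOp/rOp` (K(h_□)G′(□)h_□ and
R = Σ_□K(h_□)G′(□)h_□, reader r03), `B6Prop23Chain.mat/apply_eq_sum_mat` (matrix entries T(δ_{y})(x)),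
`B6CoverBox.hprof/bdist/Kbox/abs_hprof_sub_le/bdist_triangle/card_filter_hprof_ne_zero_le` (the profile h_□ of (2.36) =
[B5] (1.118) with its Lipschitz bound (3π/2)/M, the ℓ¹ distance, the overlap number 2^d),
`B6Ineq249Proof.box_neumann250_of_244` (gen 1 of this seat).
WHAT THE PAPER PRINTS (p. 230 [PDF 8], verbatim): *"Rescaling all the expressions in K(h_□)G′(□)h_□λ to L^{−j}-scale, we get
(K(h_□)G′(□)h_□λ)(L^jηx) = Σ_{b∈st(x)}(∂^{L^{−j}}h_□)(b)(∂^{L^{−j}}G′(□)h_□λ)(b) − (Δ^{L^{−j}}h_□)(x)(G′(□)h_□λ)(x) − a_j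
Σ_{x′∈B^j(y^j(x))} L^{−jd}(∂^{L^{−j}}h_□)(Γ^{(j)}_{x,y^j(x),x′})(G′(□)h_□λ)(x′) if x ∈ B^j(Λ_j) ⊂ T_{L^{−j}}, (2.40) … From
these and (2.42) we get |(G′(□)λ)(x)|, |(∂^{L^{−j}}_μG′(□)λ)(x)| ≤ O(1)e^{−δ₀dist(x,supp λ)}|λ|. (2.43) This inequality and
(2.40) imply |(K(h_□)G′(□)h_□λ)(x)| ≤ O(M⁻¹)e^{−δ₀|x−y|}|λ| (2.44) if either supp λ ⊂ B^j(y) for y ∈ Λ_j, or supp λ ⊂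
B^{j+1}(y) for y ∈ Λ_{j+1}. The distance in the above inequality is measured on L^{−j}-scale."*; p. 229: the cubes □ have
*"the size 2ML^jη"* and the functions h_□ are *"the corresponding family of functions h described in (1.118) … rescale[d]
to proper scales"* — so every derivative of h_□ in (2.40) is O(M⁻¹) on the L^{−j}-scale; p. 235: *"If we have one scale,
i.e. Λ_k = T₁^{(k)}, then the operator is a unit lattice operator."*
WHAT IS PROVED HERE (0 sorry, 0 new definitions, 0 named facts), on the box 𝔅 = {0,…,nM}^d of `B6CoverBox.boxGeo` with
blocks = sites (one scale, unit-lattice operators), the cut-offs `h_k` acting as multiplication by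
`hprof m k` (h_k(x) = Π_μ h((x_μ − k_μM)/M)): `bTerm_single_apply` (private; the exact lattice form of (2.40) before
summation by parts: `(K(h_k)G′(□_k)h_k)(x,y) = h_k(y)Σ_{x′}Δ′_a(x,x′)(h_k(x) − h_k(x′))G′(□_k)(x′,y)` — every term carries a
DIFFERENCE of h_k); **`box_kernel244_of_243`** — if `Δ′_a` has short weighted range `Σ_{x′}|Δ′_a(x,x′)||x−x′|₁e^{δ₀|x−x′|₁}
≤ κ` (κ = 2d·e^{δ₀} for the unit Laplacian plus ANY diagonal term, e.g. the a·I of Δ′_a = Δ + Q′*aQ′ on one scale: the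
diagonal does not see the commutator) and the local inverses obey the first entry of (2.43) in matrix form
`|G′(□_k)(x′,y)| ≤ Ae^{−δ₀|x′−y|₁}`, then **`|(K(h_k)G′(□_k)h_k)(x,y)| ≤ (3π/2)Aκ·M⁻¹·e^{−δ₀|x−y|₁}`** for every cube k and all
x, y — (2.44) with O(M⁻¹) = (3π/2)AκM⁻¹ (3π/2 = the Lipschitz constant of the tree's explicit profile h);
**`box_kernel251_of_243`** — summed over the ≤ 2^d cubes whose cut-off does not vanish at y
(`B6CoverBox.card_filter_hprof_ne_zero_le`): `|R(x,y)| ≤ 2^d(3π/2)AκM⁻¹e^{−δ₀|x−y|₁}`, (2.51) p. 232 on the model;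
`weightedRange_of_nearestNeighbour` (the printed nearest-neighbour case:
range 1 and off-diagonal row sums ≤ κ₀ give κ = κ₀e^{δ₀}; κ₀ = 2d for the unit Laplacian); `box_kernel244_of_243_clm` /
**`box_neumann250_of_243`** (the same (2.44) for the continuous-linear-map operators of `B6Ineq249Proof` §4, hence (2.43)
alone ⇒ (2.49) ⇒ (2.50): the random-walk series converges to G′ in the L^∞ operator norm for M > 2^dK(δ₀)(3π/2)Aκ —
this seat's gen-1 `box_neumann250_of_244` with its (2.44)-hypothesis discharged).
v1.1 (append-only, §Closing): **`box_kernel266_of_243`** — by `B6Ineq266Proof.box_kernel266_of_243_244` (this seat's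
(2.64)–(2.66) file), for `G′` with `G′Δ′_a = I`, local inverses `h_kΔ′_aG′(□_k)h_k = h_kh_k` and **M > 2^d(3π/2)Aκ·K(αδ₀)**
(the printed *"M sufficiently large"*, explicit; K(a) = (2(1 − e^{−a})⁻¹)^d, 0 < αδ₀, 0 ≤ δ₀, α ≤ 1): `|G′(x,y)| ≤
2^dA·K(αδ₀)(1 − 2^d(3π/2)AκM⁻¹K(αδ₀))⁻¹e^{−(1−α)δ₀|x−y|₁}` — (2.66)/(2.67)₁ on the model from (2.43) ALONE.
ROUTE (deviation from print, declared): print obtains (2.44) from (2.40), i.e. AFTER summation by parts, pairing ∂h_□ =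
O(M⁻¹) with the derivative entry ∂G′(□) of (2.43); here the exact commutator identity [h_k, Δ′_a](x,x′) = (h_k(x) −
h_k(x′))Δ′_a(x,x′) is bounded directly by the Lipschitz bound of h_k and the FIRST entry of (2.43) (triangle inequality
e^{−δ₀|x′−y|} ≤ e^{δ₀|x−x′|}e^{−δ₀|x−y|}) — the same mechanism ("h_□ varies on the scale M"), a shorter road on the lattice.
The print-form derivation over an ABSTRACT multiscale geometry (K(h) = P∘D + C with local coefficient operators, both
entries of (2.43), the coefficient sizes as hypotheses) is the tree's `B6RandomWalkHom.b9_389_of_342` (cell b2b); this file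
is the concrete one-scale instance with the coefficient size COMPUTED from the explicit profile, not a re-derivation of it.
NOT proved here: (2.43) itself (row `B6.Eq2.43`/`B6.Eq2.41`: Lemmas 2.2, 2.4, Prop. 2.3 of [3] via (2.41)–(2.42)); the
two-level case of (2.44) (*"or supp λ ⊂ B^{j+1}(y)"*, the last term of (2.40) with the factor L^{−2}); fine lattices
X ≠ 𝔅 (there h_□ is smooth on the fine scale, not block-constant — the abstract §1 of `…B6Ineq266Proof` covers them
with (2.44) as a hypothesis); the derivative entries.
-/

namespace Literature.MathematicalPhysics.QuantumFieldTheory.Balaban1983to89.B6Ineq244BoxProof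

open Finset
open B6Eq250 (kOp bTerm gZero rOp)

/-! ## (2.43) + (2.40) ⇒ (2.44) on the printed cover (blocks = sites): the commutator `K(h_□) = h_□Δ′_a − Δ′_ah_□`
is O(M⁻¹) because h_□ varies on the scale M -/

section Commutator

open B6CoverBox (hprof bdist Kbox hprof_nonneg hprof_le_one abs_hprof_sub_le bdist_triangle bdist_nonneg bdist_self
  card_filter_hprof_ne_zero_le)
open B6Prop23Chain (mat apply_eq_sum_mat)

variable {d n m : ℕ}

/-- The matrix entries of the sandwiched commutator term of (2.38)/(2.40) on the model: with `h_k` = multiplication by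
the profile, `(K(h_k)G′(□_k)h_k)(x,y) = h_k(y)·Σ_{x′} Δ′_a(x,x′)(h_k(x) − h_k(x′))G′(□_k)(x′,y)` — the lattice form of
*"(K(h_□)G′(□)h_□λ)(x) = Σ_{b∈st(x)}(∂h_□)(b)(∂G′(□)h_□λ)(b) − (Δh_□)(x)(G′(□)h_□λ)(x) − …"* (2.40) before summation by
parts: every term carries a DIFFERENCE of h_□. [cite: Balaban1984PropagatorsII, (2.40) p.230] -/
private theorem bTerm_single_apply (D : Module.End ℝ ((Fin d → Fin (n * m + 1)) → ℝ))
    (h gl : (Fin d → Fin (n + 1)) → Module.End ℝ ((Fin d → Fin (n * m + 1)) → ℝ))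
    (hmul : ∀ k μ x, h k μ x = hprof m k x * μ x) (k : Fin d → Fin (n + 1))
    (y x : Fin d → Fin (n * m + 1)) :
    bTerm D h gl k (Pi.single y 1) x =
      hprof m k y * ∑ x', mat D x x' * ((hprof m k x - hprof m k x') * gl k (Pi.single y 1) x') := by
  have hsingle : h k (Pi.single y 1) =
      hprof m k y • (Pi.single y (1 : ℝ) : (Fin d → Fin (n * m + 1)) → ℝ) := by
    funext z
    rw [hmul, Pi.smul_apply, smul_eq_mul]
    by_cases hz : z = y
    · subst hz; simp
    · simp [Pi.single_eq_of_ne hz]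
  rw [B6Eq250.bTerm_apply, B6Eq250.kOp_def, Module.End.mul_apply, Module.End.mul_apply, hsingle, map_smul,
    map_smul, Pi.smul_apply, smul_eq_mul]
  congr 1
  set v := gl k (Pi.single y 1) with hv
  rw [LinearMap.sub_apply, Pi.sub_apply, Module.End.mul_apply, Module.End.mul_apply, hmul,
    apply_eq_sum_mat D v x, apply_eq_sum_mat D (h k v) x, Finset.mul_sum, ← Finset.sum_sub_distrib]
  refine Finset.sum_congr rfl fun x' _ => ?_
  rw [hmul]
  ring

/-- **(2.43) + (2.40) ⇒ (2.44) ON THE PRINTED COVER (blocks = sites — p. 235 *"If we have one scale … the operator is a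
unit lattice operator"*), with the O(M⁻¹) EXPLICIT.**  p. 230: *"This inequality [(2.43)] and (2.40) imply
|(K(h_□)G′(□)h_□λ)(x)| ≤ O(M⁻¹)e^{−δ₀|x−y|}|λ| (2.44)"*.  On the model: if the cut-offs `h_k` act as multiplication by the
profiles `h_k(x) = Π_μ h((x_μ − k_μM)/M)` of (2.36) (Lipschitz: |h_k(x) − h_k(x′)| ≤ (3π/2)M⁻¹|x − x′|₁,
`B6CoverBox.abs_hprof_sub_le`), the operator `Δ′_a` (`D`) has short range in the weighted sense
`Σ_{x′}|Δ′_a(x,x′)|·|x−x′|₁e^{δ₀|x−x′|₁} ≤ κ` (κ = 2d·e^{δ₀} for the unit-lattice Laplacian plus any diagonal term — the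
diagonal does not see the commutator), and the local inverses obey the first entry of (2.43) in matrix form
`|G′(□_k)(x′,y)| ≤ Ae^{−δ₀|x′−y|₁}`, then every summand of `R` obeys **`|(K(h_k)G′(□_k)h_k)(x,y)| ≤ (3π/2)Aκ·M⁻¹·
e^{−δ₀|x−y|₁}`** — (2.44) with O(M⁻¹) = (3π/2)Aκ/M.  (Route: the exact commutator identity [h_k, Δ′_a](x,x′) =
(h_k(x) − h_k(x′))Δ′_a(x,x′) and the triangle inequality; print pairs ∂h_□ with ∂G′(□) via (2.40) and the derivative
entry of (2.43) instead — same mechanism, this road needs the first entry only.) [cite: Balaban1984PropagatorsII, (2.44) p.230] -/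
theorem box_kernel244_of_243 (hm : 0 < m) {δ₀ κ A : ℝ} (hδ₀ : 0 ≤ δ₀) (hA : 0 ≤ A)
    (D : Module.End ℝ ((Fin d → Fin (n * m + 1)) → ℝ))
    (h gl : (Fin d → Fin (n + 1)) → Module.End ℝ ((Fin d → Fin (n * m + 1)) → ℝ))
    (hmul : ∀ k μ x, h k μ x = hprof m k x * μ x)
    (hD : ∀ x, ∑ x', |D (Pi.single x' 1) x| * (bdist x x' * Real.exp (δ₀ * bdist x x')) ≤ κ)
    (h243 : ∀ k y x, |gl k (Pi.single y 1) x| ≤ A * Real.exp (-(δ₀ * bdist x y)))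
    (k : Fin d → Fin (n + 1)) (y x : Fin d → Fin (n * m + 1)) :
    |bTerm D h gl k (Pi.single y 1) x| ≤ 3 * Real.pi / 2 * A * κ / m * Real.exp (-(δ₀ * bdist x y)) := by
  have hm' : (0 : ℝ) < m := by exact_mod_cast hm
  rw [bTerm_single_apply D h gl hmul k y x, abs_mul]
  have hhy : |hprof m k y| ≤ 1 := by
    rw [abs_of_nonneg (hprof_nonneg m k y)]
    exact hprof_le_one m k y
  have hterm : ∀ x', |mat D x x' * ((hprof m k x - hprof m k x') * gl k (Pi.single y 1) x')| ≤
      |D (Pi.single x' 1) x| * (bdist x x' * Real.exp (δ₀ * bdist x x')) *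
        (3 * Real.pi / 2 / m * A * Real.exp (-(δ₀ * bdist x y))) := by
    intro x'
    rw [abs_mul, abs_mul]
    have h1 : |hprof m k x - hprof m k x'| ≤ 3 * Real.pi / 2 / m * bdist x x' := abs_hprof_sub_le hm k x x'
    have h2 : |gl k (Pi.single y 1) x'| ≤ A * Real.exp (-(δ₀ * bdist x' y)) := h243 k y x'
    have h3 : Real.exp (-(δ₀ * bdist x' y)) ≤ Real.exp (δ₀ * bdist x x') * Real.exp (-(δ₀ * bdist x y)) := by
      rw [← Real.exp_add]
      apply Real.exp_le_exp.mpr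
      have htri := mul_le_mul_of_nonneg_left (bdist_triangle x x' y) hδ₀
      rw [mul_add] at htri
      linarith
    have hd0 : 0 ≤ bdist x x' := bdist_nonneg x x'
    have hmatD : |mat D x x'| = |D (Pi.single x' 1) x| := rfl
    calc |mat D x x'| * (|hprof m k x - hprof m k x'| * |gl k (Pi.single y 1) x'|)
        ≤ |mat D x x'| * (3 * Real.pi / 2 / m * bdist x x' *
            (A * (Real.exp (δ₀ * bdist x x') * Real.exp (-(δ₀ * bdist x y))))) := by
          refine mul_le_mul_of_nonneg_left ?_ (abs_nonneg _)
          exact mul_le_mul h1 (h2.trans (mul_le_mul_of_nonneg_left h3 hA)) (abs_nonneg _) (by positivity)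
      _ = _ := by rw [hmatD]; ring
  calc |hprof m k y| * |∑ x', mat D x x' * ((hprof m k x - hprof m k x') * gl k (Pi.single y 1) x')|
      ≤ 1 * ∑ x', |D (Pi.single x' 1) x| * (bdist x x' * Real.exp (δ₀ * bdist x x')) *
          (3 * Real.pi / 2 / m * A * Real.exp (-(δ₀ * bdist x y))) :=
        mul_le_mul hhy ((Finset.abs_sum_le_sum_abs _ _).trans (Finset.sum_le_sum fun x' _ => hterm x'))
          (abs_nonneg _) zero_le_one
    _ = (∑ x', |D (Pi.single x' 1) x| * (bdist x x' * Real.exp (δ₀ * bdist x x'))) *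
          (3 * Real.pi / 2 / m * A * Real.exp (-(δ₀ * bdist x y))) := by rw [one_mul, Finset.sum_mul]
    _ ≤ κ * (3 * Real.pi / 2 / m * A * Real.exp (-(δ₀ * bdist x y))) :=
        mul_le_mul_of_nonneg_right (hD x) (by positivity)
    _ = 3 * Real.pi / 2 * A * κ / m * Real.exp (-(δ₀ * bdist x y)) := by ring

/-- **(2.43) ⇒ (2.51) on the printed cover (blocks = sites, matrix form).**  p. 232: *"|(Rλ)(x)| ≤ O(M⁻¹)e^{−δ₀d(x,y)}|λ|
for supp λ ⊂ B^j(y)"* (2.51).  On the model, summing (2.44) (`box_kernel244_of_243`) over the at most 2^d cubes □_k whose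
cut-off does not vanish at `y` (`B6CoverBox.card_filter_hprof_ne_zero_le`; the other summands of `R = Σ_k K(h_k)G′(□_k)h_k`
annihilate `δ_y`): **`|R(x,y)| ≤ 2^d·(3π/2)Aκ·M⁻¹·e^{−δ₀|x−y|₁}`**. [cite: Balaban1984PropagatorsII, (2.51) p.232] -/
theorem box_kernel251_of_243 (hm : 0 < m) {δ₀ κ A : ℝ} (hδ₀ : 0 ≤ δ₀) (hA : 0 ≤ A)
    (D : Module.End ℝ ((Fin d → Fin (n * m + 1)) → ℝ))
    (h gl : (Fin d → Fin (n + 1)) → Module.End ℝ ((Fin d → Fin (n * m + 1)) → ℝ))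
    (hmul : ∀ k μ x, h k μ x = hprof m k x * μ x)
    (hD : ∀ x, ∑ x', |D (Pi.single x' 1) x| * (bdist x x' * Real.exp (δ₀ * bdist x x')) ≤ κ)
    (h243 : ∀ k y x, |gl k (Pi.single y 1) x| ≤ A * Real.exp (-(δ₀ * bdist x y)))
    (y x : Fin d → Fin (n * m + 1)) :
    |rOp D h gl (Pi.single y 1) x| ≤
      (2 : ℝ) ^ d * (3 * Real.pi / 2 * A * κ / m) * Real.exp (-(δ₀ * bdist x y)) := by
  classical
  have hκ : 0 ≤ κ :=
    (Finset.sum_nonneg fun x' _ => mul_nonneg (abs_nonneg _)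
      (mul_nonneg (bdist_nonneg x x') (Real.exp_nonneg _))).trans (hD x)
  set S : Finset (Fin d → Fin (n + 1)) := Finset.univ.filter fun k => hprof m k y ≠ 0 with hS
  have hvanish : ∀ k ∉ S, bTerm D h gl k (Pi.single y 1) x = 0 := by
    intro k hk
    have hky : hprof m k y = 0 := by simpa [hS] using hk
    have hh : h k (Pi.single y 1) = 0 := by
      funext z
      rw [hmul, Pi.zero_apply]
      by_cases hz : z = y
      · rw [hz, hky, zero_mul]
      · rw [Pi.single_eq_of_ne hz, mul_zero]
    have hb : bTerm D h gl k (Pi.single y 1) = 0 := by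
      rw [B6Eq250.bTerm_apply, Module.End.mul_apply, Module.End.mul_apply, hh, map_zero, map_zero]
    rw [hb, Pi.zero_apply]
  rw [B6Eq250.rOp_eq_sum_bTerm, LinearMap.sum_apply, Finset.sum_apply,
    ← Finset.sum_subset (Finset.subset_univ S) fun k _ hk => hvanish k hk]
  calc |∑ k ∈ S, bTerm D h gl k (Pi.single y 1) x|
      ≤ ∑ k ∈ S, |bTerm D h gl k (Pi.single y 1) x| := Finset.abs_sum_le_sum_abs _ _
    _ ≤ ∑ k ∈ S, 3 * Real.pi / 2 * A * κ / m * Real.exp (-(δ₀ * bdist x y)) :=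
        Finset.sum_le_sum fun k _ => box_kernel244_of_243 hm hδ₀ hA D h gl hmul hD h243 k y x
    _ = S.card * (3 * Real.pi / 2 * A * κ / m * Real.exp (-(δ₀ * bdist x y))) := by
        rw [Finset.sum_const, nsmul_eq_mul]
    _ ≤ (2 : ℝ) ^ d * (3 * Real.pi / 2 * A * κ / m * Real.exp (-(δ₀ * bdist x y))) := by
        refine mul_le_mul_of_nonneg_right ?_ (by positivity)
        exact_mod_cast card_filter_hprof_ne_zero_le hm y
    _ = _ := by ring

/-- **The weighted-range hypothesis for a nearest-neighbour `Δ′_a`** (the printed case: Δ′_a = Δ + Q′*aQ′ is, on one scale,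
the unit-lattice Laplacian plus a diagonal term, p. 225 (2.13) / p. 235): if `Δ′_a(x,x′) = 0` whenever `|x − x′|₁ > 1` and the
off-diagonal absolute row sums are `≤ κ₀` (κ₀ = 2d for the unit Laplacian: at most 2d neighbours, coefficient 1), then
`Σ_{x′}|Δ′_a(x,x′)|·|x−x′|₁e^{δ₀|x−x′|₁} ≤ κ₀e^{δ₀}` — the `hD` of `box_kernel244_of_243` with κ = κ₀e^{δ₀} (the diagonal
entry is killed by the factor |x − x|₁ = 0). [cite: Balaban1984PropagatorsII, (2.13) p.225, (2.40) p.230] -/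
theorem weightedRange_of_nearestNeighbour {δ₀ κ₀ : ℝ} (hδ₀ : 0 ≤ δ₀)
    (D : Module.End ℝ ((Fin d → Fin (n * m + 1)) → ℝ))
    (hrange : ∀ x x', 1 < bdist x x' → D (Pi.single x' 1) x = 0)
    (hrow : ∀ x, ∑ x' ∈ Finset.univ.filter (fun x' => x' ≠ x), |D (Pi.single x' 1) x| ≤ κ₀)
    (x : Fin d → Fin (n * m + 1)) :
    ∑ x', |D (Pi.single x' 1) x| * (bdist x x' * Real.exp (δ₀ * bdist x x')) ≤ κ₀ * Real.exp δ₀ := by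
  have hterm : ∀ x', |D (Pi.single x' 1) x| * (bdist x x' * Real.exp (δ₀ * bdist x x')) ≤
      if x' ≠ x then |D (Pi.single x' 1) x| * Real.exp δ₀ else 0 := by
    intro x'
    by_cases hx : x' ≠ x
    · rw [if_pos hx]
      by_cases hfar : 1 < bdist x x'
      · simp [hrange x x' hfar]
      · have hfar : bdist x x' ≤ 1 := not_lt.mp hfar
        have hd0 : 0 ≤ bdist x x' := bdist_nonneg x x'
        refine mul_le_mul_of_nonneg_left ?_ (abs_nonneg _)
        calc bdist x x' * Real.exp (δ₀ * bdist x x') ≤ 1 * Real.exp (δ₀ * 1) :=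
              mul_le_mul hfar (Real.exp_le_exp.mpr (mul_le_mul_of_nonneg_left hfar hδ₀)) (Real.exp_nonneg _)
                zero_le_one
          _ = Real.exp δ₀ := by rw [one_mul, mul_one]
    · rw [if_neg hx, not_ne_iff.mp hx, bdist_self, zero_mul, mul_zero]
  calc ∑ x', |D (Pi.single x' 1) x| * (bdist x x' * Real.exp (δ₀ * bdist x x'))
      ≤ ∑ x', (if x' ≠ x then |D (Pi.single x' 1) x| * Real.exp δ₀ else 0) := Finset.sum_le_sum fun x' _ => hterm x'
    _ = ∑ x' ∈ Finset.univ.filter (fun x' => x' ≠ x), |D (Pi.single x' 1) x| * Real.exp δ₀ := by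
        rw [Finset.sum_filter]
    _ = (∑ x' ∈ Finset.univ.filter (fun x' => x' ≠ x), |D (Pi.single x' 1) x|) * Real.exp δ₀ := by
        rw [Finset.sum_mul]
    _ ≤ κ₀ * Real.exp δ₀ := mul_le_mul_of_nonneg_right (hrow x) (Real.exp_nonneg _)

/-! ## The same input for the L^∞ operator algebra of `B6Ineq249Proof` §3–§4: (2.43) alone ⇒ (2.49) ⇒ (2.50) on the cover -/

/-- Bookkeeping: the sandwiched commutator term `K(h_k)G′(□_k)h_k` is the same map whether it is formed in the ring of
continuous linear maps of L^∞ (as in `B6Ineq249Proof.box_ineq249` / `box_neumann250_of_244`) or in `Module.End`. [folklore] -/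
private theorem bTerm_coe_apply {ι : Type*} (D : ((Fin d → Fin (n * m + 1)) → ℝ) →L[ℝ] ((Fin d → Fin (n * m + 1)) → ℝ))
    (h gl : ι → ((Fin d → Fin (n * m + 1)) → ℝ) →L[ℝ] ((Fin d → Fin (n * m + 1)) → ℝ)) (k : ι)
    (μ : (Fin d → Fin (n * m + 1)) → ℝ) (x : Fin d → Fin (n * m + 1)) :
    bTerm D h gl k μ x =
      bTerm (D : Module.End ℝ ((Fin d → Fin (n * m + 1)) → ℝ))
        (fun i => (h i : Module.End ℝ ((Fin d → Fin (n * m + 1)) → ℝ)))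
        (fun i => (gl i : Module.End ℝ ((Fin d → Fin (n * m + 1)) → ℝ))) k μ x := by
  simp only [B6Eq250.bTerm_apply, B6Eq250.kOp_def, mul_apply_eq_comp, sub_apply,
    Pi.sub_apply, Module.End.mul_apply, LinearMap.sub_apply, ContinuousLinearMap.coe_coe]

/-- **(2.44) from (2.43) for the operators of `B6Ineq249Proof` §4** (continuous linear maps on L^∞ of the box, blocks =
sites): the kernel bound `|(K(h_k)G′(□_k)h_k)(x,y)| ≤ (3π/2)Aκ·M⁻¹·e^{−δ₀|x−y|₁}` of `box_kernel244_of_243`, verbatim the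
hypothesis `h244` of `B6Ineq249Proof.box_ineq249` / `box_neumann250_of_244` with θ = (3π/2)Aκ/M.
[cite: Balaban1984PropagatorsII, (2.44) p.230] -/
private theorem box_kernel244_of_243_clm (hm : 0 < m) {δ₀ κ A : ℝ} (hδ₀ : 0 ≤ δ₀) (hA : 0 ≤ A)
    (D : ((Fin d → Fin (n * m + 1)) → ℝ) →L[ℝ] ((Fin d → Fin (n * m + 1)) → ℝ))
    (h gl : (Fin d → Fin (n + 1)) → ((Fin d → Fin (n * m + 1)) → ℝ) →L[ℝ] ((Fin d → Fin (n * m + 1)) → ℝ))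
    (hmul : ∀ k μ x, h k μ x = hprof m k x * μ x)
    (hD : ∀ x, ∑ x', |D (Pi.single x' 1) x| * (bdist x x' * Real.exp (δ₀ * bdist x x')) ≤ κ)
    (h243 : ∀ k y x, |gl k (Pi.single y 1) x| ≤ A * Real.exp (-(δ₀ * bdist x y)))
    (k : Fin d → Fin (n + 1)) (y x : Fin d → Fin (n * m + 1)) :
    |bTerm D h gl k (Pi.single y 1) x| ≤ 3 * Real.pi / 2 * A * κ / m * Real.exp (-(δ₀ * bdist x y)) := by
  rw [bTerm_coe_apply]
  exact box_kernel244_of_243 hm hδ₀ hA (D : Module.End ℝ ((Fin d → Fin (n * m + 1)) → ℝ))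
    (fun i => (h i : Module.End ℝ ((Fin d → Fin (n * m + 1)) → ℝ)))
    (fun i => (gl i : Module.End ℝ ((Fin d → Fin (n * m + 1)) → ℝ)))
    (fun k μ x => by simpa only [ContinuousLinearMap.coe_coe] using hmul k μ x)
    (fun x => by simpa only [ContinuousLinearMap.coe_coe] using hD x)
    (fun k y x => by simpa only [ContinuousLinearMap.coe_coe] using h243 k y x) k y x

/-- **(2.43) ALONE ⇒ (2.49) ⇒ (2.50) on the printed cover**: with `h_k` = multiplication by the cut-offs of (2.36), local
inverses `G′(□_k)` (`h_kΔ′_aG′(□_k)h_k = h_kh_k`), `G′Δ′_a = I`, `Δ′_a` of short weighted range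
`Σ_{x′}|Δ′_a(x,x′)||x−x′|₁e^{δ₀|x−x′|₁} ≤ κ` (δ₀ > 0) and the first entry of (2.43) for the `G′(□_k)`: if
**M > 2^dK(δ₀)·(3π/2)Aκ** then the random-walk series (2.50) `G′₀Σ_NR^N` converges to `G′` in the operator norm of L^∞ of the
box — this seat's `B6Ineq249Proof.box_neumann250_of_244` with its (2.44)-hypothesis DISCHARGED by `box_kernel244_of_243_clm`
(θ = (3π/2)Aκ/M, c = (3π/2)Aκ). [cite: Balaban1984PropagatorsII, (2.49)–(2.50) p.232; (2.43)–(2.44) p.230] -/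
theorem box_neumann250_of_243 (hm : 0 < m) {δ₀ κ A : ℝ} (hδ₀ : 0 < δ₀) (hA : 0 ≤ A) (hκ : 0 ≤ κ)
    (D Gp : ((Fin d → Fin (n * m + 1)) → ℝ) →L[ℝ] ((Fin d → Fin (n * m + 1)) → ℝ))
    (h gl : (Fin d → Fin (n + 1)) → ((Fin d → Fin (n * m + 1)) → ℝ) →L[ℝ] ((Fin d → Fin (n * m + 1)) → ℝ))
    (hmul : ∀ k μ x, h k μ x = hprof m k x * μ x) (hGD : Gp * D = 1)
    (hloc : ∀ k, h k * D * gl k * h k = h k * h k)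
    (hD : ∀ x, ∑ x', |D (Pi.single x' 1) x| * (bdist x x' * Real.exp (δ₀ * bdist x x')) ≤ κ)
    (h243 : ∀ k y x, |gl k (Pi.single y 1) x| ≤ A * Real.exp (-(δ₀ * bdist x y)))
    (hM : (2 : ℝ) ^ d * Kbox d δ₀ * (3 * Real.pi / 2 * A * κ) < m) :
    HasSum (fun N : ℕ => gZero h gl * rOp D h gl ^ N) Gp :=
  B6Ineq249Proof.box_neumann250_of_244 hm hδ₀ (θ := 3 * Real.pi / 2 * A * κ / m) (c := 3 * Real.pi / 2 * A * κ)
    (by positivity) D Gp h gl hmul hGD hloc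
    (fun k b x => box_kernel244_of_243_clm hm hδ₀.le hA D h gl hmul hD h243 k b x)
    (le_of_eq (div_eq_mul_inv _ _)) hM

end Commutator

/-! ## v1.1 (append-only). (2.43) ALONE ⇒ (2.66) on the printed cover: this file's (2.44) fed to
`B6Ineq266Proof.box_kernel266_of_243_244` -/

section Closing

open B6CoverBox (hprof bdist Kbox)
open B6Ineq266Proof (box_kernel266_of_243_244)

variable {d n m : ℕ}

/-- **(2.43) ALONE ⇒ (2.66) on the printed cover (blocks = sites, matrix form), "M sufficiently large" EXPLICIT.**  With
the cut-offs `h_k` of (2.36), `G′Δ′_a = I`, local inverses `G′(□_k)` (`h_kΔ′_aG′(□_k)h_k = h_kh_k`), `Δ′_a` of short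
weighted range `Σ_{x′}|Δ′_a(x,x′)||x−x′|₁e^{δ₀|x−x′|₁} ≤ κ`, and the first entry of (2.43) `|G′(□_k)(x,y)| ≤ Ae^{−δ₀|x−y|₁}`:
if **M > 2^d·(3π/2)Aκ·K(αδ₀)** (0 < αδ₀, 0 ≤ δ₀, α ≤ 1; K(a) = (2(1 − e^{−a})⁻¹)^d) then `|G′(x,y)| ≤ 2^dA·K(αδ₀)·
(1 − 2^d(3π/2)AκM⁻¹K(αδ₀))⁻¹·e^{−(1−α)δ₀|x−y|₁}` — (2.44) supplied by `box_kernel244_of_243`, the rest by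
`box_kernel266_of_243_244`. [cite: Balaban1984PropagatorsII, Prop. 2.2 (2.66)–(2.67) p.234; (2.43)–(2.44) p.230] -/
theorem box_kernel266_of_243 (hm : 0 < m) {δ₀ α κ A : ℝ} (hαδ₀ : 0 < α * δ₀) (hδ₀ : 0 ≤ δ₀) (hα : α ≤ 1)
    (hA : 0 ≤ A) (hκ : 0 ≤ κ) (D Gp : Module.End ℝ ((Fin d → Fin (n * m + 1)) → ℝ))
    (h gl : (Fin d → Fin (n + 1)) → Module.End ℝ ((Fin d → Fin (n * m + 1)) → ℝ))
    (hmul : ∀ k μ x, h k μ x = hprof m k x * μ x) (hGD : Gp * D = 1)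
    (hloc : ∀ k, h k * D * gl k * h k = h k * h k)
    (hD : ∀ x, ∑ x', |D (Pi.single x' 1) x| * (bdist x x' * Real.exp (δ₀ * bdist x x')) ≤ κ)
    (h243 : ∀ k y x, |gl k (Pi.single y 1) x| ≤ A * Real.exp (-(δ₀ * bdist x y)))
    (hM : (2 : ℝ) ^ d * (3 * Real.pi / 2 * A * κ) * Kbox d (α * δ₀) < m) (x y : Fin d → Fin (n * m + 1)) :
    |Gp (Pi.single y 1) x| ≤
      (2 : ℝ) ^ d * A * Kbox d (α * δ₀) *
          (1 - (2 : ℝ) ^ d * (3 * Real.pi / 2 * A * κ / m) * Kbox d (α * δ₀))⁻¹ *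
        Real.exp (-((1 - α) * δ₀ * bdist x y)) := by
  have hm' : (0 : ℝ) < m := by exact_mod_cast hm
  have hsmall : (2 : ℝ) ^ d * (3 * Real.pi / 2 * A * κ / m) * Kbox d (α * δ₀) < 1 := by
    rw [show (2 : ℝ) ^ d * (3 * Real.pi / 2 * A * κ / m) * Kbox d (α * δ₀) =
        (2 : ℝ) ^ d * (3 * Real.pi / 2 * A * κ) * Kbox d (α * δ₀) / m by ring]
    exact (div_lt_one hm').mpr hM
  exact box_kernel266_of_243_244 hm hαδ₀ hδ₀ hα (θ := 3 * Real.pi / 2 * A * κ / m) (by positivity) hA D Gp h gl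
    hmul hGD hloc h243 (fun k y x => box_kernel244_of_243 hm hδ₀ hA D h gl hmul hD h243 k y x) hsmall x y

end Closing

end Literature.MathematicalPhysics.QuantumFieldTheory.Balaban1983to89.B6Ineq244BoxProof
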